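import Literature.MathematicalPhysics.QuantumFieldTheory.Balaban1983to89.Beta.PlaquetteVertex2Coords

/-!
# The `(2,2)` plaquette kernel polarised in the background: position-resolved background tables, the two-letter kernel
# `m22 i j k l Y Y′ a b`, and the fully coordinatised eight-index table `K22`

HONEST FRAMING (cell `pub-balaban`, β sub-cell, lineage an3; verbatim): discharging `BetaPertH` makes Bałaban's UV stability
UNCONDITIONAL — a real constructive-QFT result; it is NOT the continuum limit and NOT the Clay problem.  This file discharges NOTHING
of `BetaPertH`: it is finite multilinear bookkeeping — the polarisation, in the background letters, of the colour kernel `M22` of the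
lattice `(2,2)`-jet (`Beta.PlaquetteVertex2Coords`), i.e. the an3-owned algebraic input of the SECOND-ORDER background-vertex family
(one finite-range `(v ⊗ v)` kernel per ordered pair of background bonds).  ABSOLUTE RULE of the cell: no internally minted statement
enters as a cited fact; every declaration below is a definition or is kernel-proved here from the single import; NOTHING is cited.
The manuscripts under audit are not citable for their disputed steps and are not cited here.

## What is proved

Fix a plaquette `p_{μν}(x)` with its four bond POSITIONS `site e x μ ν : Fin 4 → Λ × D` (contour order), signs `sgn = (1,1,−1,−1)`, and
write `b_k := wAt e B x μ ν k` for the BACKGROUND letter at position `k` (`B₁ = B_μ(x)`, `B₂ = B_ν(x+e_μ)`, `B₃ = B_μ(x+e_ν)`,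
`B₄ = B_ν(x)`).  The entries of `PlaquetteVertex2Coords.M22` depend on `B` only through the accumulated backgrounds `bacc i`, the
accumulated commutators `cacc j`, the plaquette field `F = lcurl e B x μ ν` and the scalar-slot word `quadB`, and these are explicit
linear resp. quadratic expressions in `b_0, …, b_3` with TABULATED coefficients (§1):

* `bacc_eq_sum : bacc e B x μ ν i = Σ_k inc i k • b_k` with the INCIDENCE TABLE `inc = ((0,0,0,0),(1,0,0,0),(1,1,−1,0),(1,1,−1,−1))`
  (`inc 3 = sgn`: the last position sees the whole curl; `PlaquetteVertex2Coords.lcurl_eq_sum` is the case `F = Σ_k sgn k • b_k`);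
* `cacc_eq_sum : cacc e B x μ ν j = Σ_{k,l} cc j k l • (b_k b_l)` with the antisymmetric COMMUTATOR TABLES `cc 2 ↔ [b₀,b₁] − [b₀,b₂] − [b₁,b₂]`,
  `cc 3 ↔ [b₀,b₁] − [b₀,b₂] − [b₁,b₂] + [b₃,b₀] + [b₃,b₁] − [b₃,b₂]`, `cc 0 = cc 1 = 0` (`cc_swap`, `cc_diag`);
* `quadB_eq_sum : quadB e B x μ ν = Σ_{k,l} qq k l • (b_k b_l)` with `qq k l = [k<l]·s_k s_l + [k=l]·½` (`qq_eq_ite`).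

§2 POLARISATION.  Substituting the tables into the colour words of `mSym`/`mPair` and expanding multilinearly (one master lemma,
`PlaquetteVertex2Coords.trace_lin_mul_lin_mul`, instantiated at the six background word shapes `bw_*`; NO traciality is used — every
identity of this file holds for an arbitrary real-linear functional `τ`) gives the POSITION-RESOLVED BACKGROUND FORM: explicit word families
`pSym τ t i j k l Y Y′ a b`, `pPair τ t i j k l Y Y′ a b` — sums of at most nine values of `τ` at four-letter products of `t_a, t_b, Y, Y′`
with coefficients from the tables — such that

  `mSym_polar  : mSym τ t (bacc i) (bacc j) (cacc j) F quadB a b = Σ_k Σ_l pSym τ t i j k l b_k b_l a b`,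
  `mPair_polar : mPair τ t (bacc i) (bacc j) F quadB a b       = Σ_k Σ_l pPair τ t i j k l b_k b_l a b`,
  **`M22_polar : M22 τ t e B x μ ν i j a b = Σ_k Σ_l m22 τ t i j k l (wAt e B x μ ν k) (wAt e B x μ ν l) a b`**

with the TWO-LETTER KERNEL `m22 τ t i j k l Y Y′ a b := s_i s_j (pSym … + [i<j]·pPair …)`: the `(2,2)` vertex of ONE plaquette couples the
fluctuation letters at positions `(i, j)` (colours `a, b`) to the background letters at positions `(k, l)` of the SAME plaquette; the cells
`k ≠ l` are the DISTINCT-BOND family, the cells `k = l` the CONTACT family (two background legs on one bond; there `cc j k k = 0` and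
`qq k k = ½`).  `m22` is BILINEAR in `(Y, Y′)`: `pSym_sum_sum`, `pPair_sum_sum`, `m22_sum_sum` (expansion of both letters along any finite
family `Σ_c γ_c • Y_c`, `Σ_d δ_d • Y_d`).

§3 FULL COORDINATES.  With the background ALSO in colour coordinates, `B = field t u` (`b_k = Σ_c u_k(c) t_c`, `PlaquetteVertex2Coords.wAt_field`),
the kernel becomes the eight-index REAL TABLE `K22 τ t i j k l a b c d := m22 τ t i j k l (t c) (t d) a b` and

  **`trace_P22_plaqWord_field_field`**: for tracial `τ`,
  `τ(P22(p_{μν}(x))) = Σ_{i,j} Σ_{a,b} v_i(a) v_j(b) · Σ_{k,l} Σ_{c,d} u_k(c) u_l(d) · K22 i j k l a b c d`   at `W = field t v`, `B = field t u`,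

(`v_i(a) = cv e v x μ ν i a`, `u_k(c) = cv e u x μ ν k c`): the `(W², B²)` Taylor coefficient of `Re tr U(∂p)` along `U_b = e^{W_b} e^{B_b}` is a
finite table over (position × colour)⁴ whose entries are signed half-integer combinations of traces of four generators — the finite-range
2-stencil datum of the plaquette, background pair by background pair.  `jet22_field_field` sums it over sites and direction pairs.

Gloss.  Pure finite algebra over an arbitrary real normed algebra `𝔸`, additive group of sites `Λ`, direction type `D`, finite colour index
type `C`; the tables were cross-checked beforehand in an exact free-algebra engine (design record of the lineage, not an input).  NOT PROVED
HERE, NOT CLAIMED: the re-indexing of the position pairs `(k, l)` by lattice OFFSETS into `BubbleTable.stencilIns` data (the offsets are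
read off `site`; `PlaquetteStencilData` format), the colour traces `Σ_a (·)_{aa}` of the word families (lit1's `ColourTrace`/`ColourTraceWeights`
lane), any symmetric one-matrix operator form, any value or bound, gauge fixing/averaging, anything of `BetaPertH`, UV stability, the
continuum limit or the Clay problem.  GAPS record C-beta-an3-31 (HOME/GAPS.md of the cell).  All tags [folklore].
-/

noncomputable section

namespace Literature.MathematicalPhysics.QuantumFieldTheory.Balaban1983to89.Beta.PlaquetteVertex2Polar

open Finset
open scoped BigOperators
open Literature.MathematicalPhysics.QuantumFieldTheory.Balaban1983to89.Beta.WilsonVertex2 (ad₂ P22)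
open Literature.MathematicalPhysics.QuantumFieldTheory.Balaban1983to89.Beta.PlaquetteVertex (lcurl plaqWord field)
open Literature.MathematicalPhysics.QuantumFieldTheory.Balaban1983to89.Beta.PlaquetteVertex2 (jet22)
open Literature.MathematicalPhysics.QuantumFieldTheory.Balaban1983to89.Beta.SpinTable (br plaqPairs)
open Literature.MathematicalPhysics.QuantumFieldTheory.Balaban1983to89.Beta.PlaquetteVertex2Coords

/-! ## §1 Background position tables -/

section Tables

/-- THE INCIDENCE TABLE of the accumulated backgrounds: `bacc i = Σ_k inc i k • b_k`, rows `(0,0,0,0), (1,0,0,0), (1,1,−1,0), (1,1,−1,−1)`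
(position `0` sees no background, position `1` sees `B₁`, position `2` sees `F + B₄ = B₁ + B₂ − B₃`, position `3` sees `F`). [folklore] -/
def inc : Fin 4 → Fin 4 → ℝ := ![![0, 0, 0, 0], ![1, 0, 0, 0], ![1, 1, -1, 0], ![1, 1, -1, -1]]

/-- THE COMMUTATOR TABLES of the accumulated commutators: `cacc j = Σ_{k,l} cc j k l • (b_k b_l)`; `cc 0 = cc 1 = 0`,
`cc 2 ↔ [b₀,b₁] − [b₀,b₂] − [b₁,b₂]`, `cc 3 ↔ cc 2 + [b₃,b₀] + [b₃,b₁] − [b₃,b₂]` (antisymmetric in `(k,l)`). [folklore] -/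
def cc : Fin 4 → Fin 4 → Fin 4 → ℝ :=
  ![0, 0, ![![0, 1, -1, 0], ![-1, 0, -1, 0], ![1, 1, 0, 0], ![0, 0, 0, 0]],
    ![![0, 1, -1, -1], ![-1, 0, -1, -1], ![1, 1, 0, 1], ![1, 1, -1, 0]]]

/-- THE QUADRATIC TABLE of the scalar-slot word: `quadB = Σ_{k,l} qq k l • (b_k b_l)`, `qq k l = [k<l]·s_k s_l + [k=l]·½`. [folklore] -/
def qq : Fin 4 → Fin 4 → ℝ := ![![2⁻¹, 1, -1, -1], ![0, 2⁻¹, -1, -1], ![0, 0, 2⁻¹, 1], ![0, 0, 0, 2⁻¹]]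

/-- `qq` in closed form: strictly upper cells carry the sign products, diagonal (CONTACT) cells `½`, lower cells `0`. [folklore] -/
theorem qq_eq_ite (k l : Fin 4) : qq k l = if k < l then sgn k * sgn l else if k = l then 2⁻¹ else 0 := by
  fin_cases k <;> fin_cases l <;> simp [qq, sgn]

/-- the last position sees the whole curl: `inc 3 = sgn`. [folklore] -/
theorem inc_three : inc 3 = sgn := by
  funext k; fin_cases k <;> simp [inc, sgn]

/-- the first position sees no background: `inc 0 = 0`. [folklore] -/
theorem inc_zero : inc 0 = 0 := by
  funext k; fin_cases k <;> simp [inc]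

/-- the commutator tables are antisymmetric in the background position pair. [folklore] -/
theorem cc_swap (j k l : Fin 4) : cc j l k = -cc j k l := by
  fin_cases j <;> fin_cases k <;> fin_cases l <;> simp [cc]

/-- CONTACT cells carry no accumulated-commutator weight: `cc j k k = 0`. [folklore] -/
theorem cc_diag (j k : Fin 4) : cc j k k = 0 := by
  fin_cases j <;> fin_cases k <;> simp [cc]

/-- CONTACT cells of the quadratic table carry `½`. [folklore] -/
theorem qq_diag (k : Fin 4) : qq k k = 2⁻¹ := by
  fin_cases k <;> simp [qq]

variable {𝔸 : Type*} [NormedRing 𝔸] [NormedAlgebra ℝ 𝔸]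
variable {Λ : Type*} [AddCommGroup Λ] {D : Type*}
variable (e : D → Λ) (B : Λ → D → 𝔸) (x : Λ) (μ ν : D)

/-- **THE ACCUMULATED BACKGROUNDS THROUGH THE INCIDENCE TABLE**: `bacc i = Σ_k inc i k • b_k`. [folklore] -/
theorem bacc_eq_sum (i : Fin 4) : bacc e B x μ ν i = ∑ k, inc i k • wAt e B x μ ν k := by
  fin_cases i <;> simp [bacc, inc, wAt, lcurl, Fin.sum_univ_four] <;> abel

/-- **THE ACCUMULATED COMMUTATORS THROUGH THE COMMUTATOR TABLES**: `cacc j = Σ_{k,l} cc j k l • (b_k b_l)`. [folklore] -/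
theorem cacc_eq_sum (j : Fin 4) : cacc e B x μ ν j = ∑ k, ∑ l, cc j k l • (wAt e B x μ ν k * wAt e B x μ ν l) := by
  fin_cases j <;> simp [cacc, cc, wAt, lcurl, br, Fin.sum_univ_four, mul_add, add_mul, mul_sub, sub_mul] <;> abel

/-- **THE SCALAR-SLOT WORD THROUGH THE QUADRATIC TABLE**: `quadB = Σ_{k,l} qq k l • (b_k b_l)`. [folklore] -/
theorem quadB_eq_sum : quadB e B x μ ν = ∑ k, ∑ l, qq k l • (wAt e B x μ ν k * wAt e B x μ ν l) := by
  simp only [quadB, qq, wAt, lcurl, plaqPairs, br, Fin.sum_univ_four, mul_sub, sub_mul, smul_add, smul_sub,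
    Matrix.cons_val_zero, Matrix.cons_val_one, Matrix.head_cons, Matrix.cons_val_two, Matrix.cons_val_three, Matrix.tail_cons,
    one_smul, neg_smul, zero_smul, add_zero, zero_add]
  module

end Tables

/-! ## §2 Background word shapes and the polarisation -/

section Words

variable {𝔸 : Type*} [NormedRing 𝔸] [NormedAlgebra ℝ 𝔸]
variable {K : Type*} [Fintype K]

/-- THE COMMUTATOR AGAINST A FIXED LETTER as a real-linear map of its FIRST argument: `brR X Y = [Y, X]`. [folklore] -/
def brR (X : 𝔸) : 𝔸 →ₗ[ℝ] 𝔸 := LinearMap.mulRight ℝ X - LinearMap.mulLeft ℝ X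

/-- `brR X Y = br Y X`. [folklore] -/
@[simp] theorem brR_apply (X Y : 𝔸) : brR X Y = br Y X := by
  simp [brR, br, LinearMap.mulLeft_apply, LinearMap.mulRight_apply]

variable (τ : 𝔸 →ₗ[ℝ] ℝ) (b : K → 𝔸) (c d : K → ℝ)

/-- background seagull shape: `τ([S, X][S′, X′])` at `S = Σ c_k b_k`, `S′ = Σ d_l b_l`. [folklore] -/
theorem bw_brbr (X X' : 𝔸) :
    τ (br (∑ k, c k • b k) X * br (∑ l, d l • b l) X') = ∑ k, ∑ l, c k * d l * τ (br (b k) X * br (b l) X') := by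
  simpa only [brR_apply, mul_one] using trace_lin_mul_lin_mul τ (brR X) (brR X') 1 b c d

/-- shape `τ(X S [S′, X′])`. [folklore] -/
theorem bw_mul_br (X X' : 𝔸) :
    τ (X * (∑ k, c k • b k) * br (∑ l, d l • b l) X') = ∑ k, ∑ l, c k * d l * τ (X * b k * br (b l) X') := by
  simpa only [brR_apply, LinearMap.mulLeft_apply, mul_one] using trace_lin_mul_lin_mul τ (LinearMap.mulLeft ℝ X) (brR X') 1 b c d

/-- shape `τ(X [S, X′] S′)`. [folklore] -/
theorem bw_br_mul (X X' : 𝔸) :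
    τ (X * br (∑ k, c k • b k) X' * (∑ l, d l • b l)) = ∑ k, ∑ l, c k * d l * τ (X * br (b k) X' * b l) := by
  simpa only [brR_apply, LinearMap.comp_apply, LinearMap.mulLeft_apply, LinearMap.id_coe, id_eq, mul_one] using
    trace_lin_mul_lin_mul τ ((LinearMap.mulLeft ℝ X).comp (brR X')) LinearMap.id 1 b c d

/-- shape `τ([S, X] X′ S′)`. [folklore] -/
theorem bw_brL_mul (X X' : 𝔸) :
    τ (br (∑ k, c k • b k) X * X' * (∑ l, d l • b l)) = ∑ k, ∑ l, c k * d l * τ (br (b k) X * X' * b l) := by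
  simpa only [brR_apply, LinearMap.comp_apply, LinearMap.mulRight_apply, LinearMap.id_coe, id_eq, mul_one] using
    trace_lin_mul_lin_mul τ ((LinearMap.mulRight ℝ X').comp (brR X)) LinearMap.id 1 b c d

/-- sandwich shape for a QUADRATIC letter `q = Σ_{k,l} e_{kl} q_{kl}`: `τ(X q X′) = Σ e_{kl} τ(X q_{kl} X′)`. [folklore] -/
theorem bw_sandwich (X X' : 𝔸) (q : K → K → 𝔸) (w : K → K → ℝ) :
    τ (X * (∑ k, ∑ l, w k l • q k l) * X') = ∑ k, ∑ l, w k l * τ (X * q k l * X') := by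
  simp only [Finset.mul_sum, Finset.sum_mul, map_sum, smul_mul_assoc, mul_smul_comm, map_smul, smul_eq_mul]

/-- right shape for a QUADRATIC letter: `τ(X q) = Σ e_{kl} τ(X q_{kl})`. [folklore] -/
theorem bw_right (X : 𝔸) (q : K → K → 𝔸) (w : K → K → ℝ) :
    τ (X * ∑ k, ∑ l, w k l • q k l) = ∑ k, ∑ l, w k l * τ (X * q k l) := by
  simp only [Finset.mul_sum, map_sum, mul_smul_comm, map_smul, smul_eq_mul]

omit [Fintype K] in
/-- the second-order transport word split into its four monomial shapes:
`τ(X · ad₂(β′,c′)(X′)) = ½(τ(X β′ [β′,X′]) − τ(X [β′,X′] β′)) + ½(τ(X c′ X′) − τ(X X′ c′))`. [folklore] -/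
theorem trace_mul_ad₂ (X β' c' X' : 𝔸) :
    τ (X * ad₂ ℝ β' c' X') = 2⁻¹ * (τ (X * β' * br β' X') - τ (X * br β' X' * β')) + 2⁻¹ * (τ (X * c' * X') - τ (X * X' * c')) := by
  have h : X * ad₂ ℝ β' c' X' = (2 : ℝ)⁻¹ • (X * β' * br β' X' - X * br β' X' * β') + (2 : ℝ)⁻¹ • (X * c' * X' - X * X' * c') := by
    simp only [ad₂, br, mul_sub, sub_mul, mul_add, smul_sub, mul_smul_comm, mul_assoc]
  rw [h, map_add, map_smul, map_smul, map_sub, map_sub, smul_eq_mul, smul_eq_mul]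

/-- a product of two coordinate combinations is the double coordinate combination of the products. [folklore] -/
theorem sum_smul_mul_sum_smul (Y : K → 𝔸) (γ δ : K → ℝ) :
    (∑ k, γ k • Y k) * (∑ l, δ l • Y l) = ∑ k, ∑ l, (γ k * δ l) • (Y k * Y l) := by
  rw [Finset.sum_mul]
  refine Finset.sum_congr rfl fun k _ => ?_
  rw [Finset.mul_sum]
  refine Finset.sum_congr rfl fun l _ => ?_
  rw [smul_mul_assoc, mul_smul_comm, smul_smul]

end Words

section Polar

variable {𝔸 : Type*} [NormedRing 𝔸] [NormedAlgebra ℝ 𝔸] {C : Type*}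

/-- THE POLARISED SYMMETRIC-BLOCK WORDS at fluctuation positions `(i, j)` and background positions `(k, l)`, background letters `Y` (at `k`)
and `Y′` (at `l`):
`pSym = inc_{ik} inc_{jl}·½τ([Y,t_a][Y′,t_b]) + inc_{jk} inc_{jl}·½(τ(t_a Y [Y′,t_b]) − τ(t_a [Y,t_b] Y′)) + cc_{jkl}·½(τ(t_a (YY′) t_b) − τ(t_a t_b (YY′)))
      + qq_{kl}·½τ(t_a t_b (YY′)) + inc_{jk} s_l·½τ(t_a [Y,t_b] Y′) + inc_{ik} s_l·½τ([Y,t_a] t_b Y′)`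
(seagull, second-order transport, accumulated commutator, scalar slot, the two symmetric spin-transport words). [folklore] -/
def pSym (τ : 𝔸 →ₗ[ℝ] ℝ) (t : C → 𝔸) (i j k l : Fin 4) (Y Y' : 𝔸) (a b : C) : ℝ :=
  inc i k * inc j l * (2⁻¹ * τ (br Y (t a) * br Y' (t b)))
    + inc j k * inc j l * (2⁻¹ * (τ (t a * Y * br Y' (t b)) - τ (t a * br Y (t b) * Y')))
    + cc j k l * (2⁻¹ * (τ (t a * (Y * Y') * t b) - τ (t a * t b * (Y * Y'))))
    + qq k l * (2⁻¹ * τ (t a * t b * (Y * Y')))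
    + (inc j k * sgn l * (2⁻¹ * τ (t a * br Y (t b) * Y')) + inc i k * sgn l * (2⁻¹ * τ (br Y (t a) * t b * Y')))

/-- THE POLARISED PAIR-BLOCK WORDS:
`pPair = qq_{kl}·½(τ(t_a t_b (YY′)) − τ(t_b t_a (YY′))) + inc_{ik} s_l·½(τ([Y,t_a] t_b Y′) − τ(t_b [Y,t_a] Y′)) + inc_{jk} s_l·½(τ(t_a [Y,t_b] Y′) − τ([Y,t_b] t_a Y′))`.
[folklore] -/
def pPair (τ : 𝔸 →ₗ[ℝ] ℝ) (t : C → 𝔸) (i j k l : Fin 4) (Y Y' : 𝔸) (a b : C) : ℝ :=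
  qq k l * (2⁻¹ * (τ (t a * t b * (Y * Y')) - τ (t b * t a * (Y * Y'))))
    + (inc i k * sgn l * (2⁻¹ * (τ (br Y (t a) * t b * Y') - τ (t b * br Y (t a) * Y')))
      + inc j k * sgn l * (2⁻¹ * (τ (t a * br Y (t b) * Y') - τ (br Y (t b) * t a * Y'))))

/-- **THE TWO-LETTER KERNEL** `m22 i j k l Y Y′ a b := s_i s_j (pSym + [i<j]·pPair)`: the coupling of the fluctuation letters at positions
`(i, j)` (colours `a, b`) to the background letters `Y, Y′` at positions `(k, l)` of the same plaquette. [folklore] -/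
def m22 (τ : 𝔸 →ₗ[ℝ] ℝ) (t : C → 𝔸) (i j k l : Fin 4) (Y Y' : 𝔸) (a b : C) : ℝ :=
  sgn i * sgn j * (pSym τ t i j k l Y Y' a b + if i < j then pPair τ t i j k l Y Y' a b else 0)

/-- at zero background letters the polarised words vanish. [folklore] -/
theorem pSym_zero (τ : 𝔸 →ₗ[ℝ] ℝ) (t : C → 𝔸) (i j k l : Fin 4) (a b : C) : pSym τ t i j k l 0 0 a b = 0 := by
  simp [pSym, br]

/-- at zero background letters the polarised pair words vanish. [folklore] -/
theorem pPair_zero (τ : 𝔸 →ₗ[ℝ] ℝ) (t : C → 𝔸) (i j k l : Fin 4) (a b : C) : pPair τ t i j k l 0 0 a b = 0 := by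
  simp [pPair, br]

variable {Λ : Type*} [AddCommGroup Λ] {D : Type*}

/-- **POLARISATION OF THE SYMMETRIC BLOCK**: `mSym(bacc i, bacc j, cacc j, F, quadB)_{ab} = Σ_k Σ_l pSym i j k l b_k b_l a b` — for ANY
real-linear `τ` (no traciality). [folklore] -/
theorem mSym_polar (τ : 𝔸 →ₗ[ℝ] ℝ) (t : C → 𝔸) (e : D → Λ) (B : Λ → D → 𝔸) (x : Λ) (μ ν : D) (i j : Fin 4) (a b : C) :
    mSym τ t (bacc e B x μ ν i) (bacc e B x μ ν j) (cacc e B x μ ν j) (lcurl e B x μ ν) (quadB e B x μ ν) a b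
      = ∑ k, ∑ l, pSym τ t i j k l (wAt e B x μ ν k) (wAt e B x μ ν l) a b := by
  rw [mSym, trace_mul_ad₂, bacc_eq_sum, bacc_eq_sum, cacc_eq_sum, lcurl_eq_sum, quadB_eq_sum]
  rw [bw_brbr, bw_mul_br, bw_br_mul, bw_sandwich, bw_right, bw_right, bw_br_mul, bw_brL_mul]
  simp only [pSym, mul_add, mul_sub, Finset.mul_sum, ← Finset.sum_add_distrib, ← Finset.sum_sub_distrib]
  refine Finset.sum_congr rfl fun k _ => Finset.sum_congr rfl fun l _ => ?_
  ring

/-- **POLARISATION OF THE PAIR BLOCK**: `mPair(bacc i, bacc j, F, quadB)_{ab} = Σ_k Σ_l pPair i j k l b_k b_l a b`. [folklore] -/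
theorem mPair_polar (τ : 𝔸 →ₗ[ℝ] ℝ) (t : C → 𝔸) (e : D → Λ) (B : Λ → D → 𝔸) (x : Λ) (μ ν : D) (i j : Fin 4) (a b : C) :
    mPair τ t (bacc e B x μ ν i) (bacc e B x μ ν j) (lcurl e B x μ ν) (quadB e B x μ ν) a b
      = ∑ k, ∑ l, pPair τ t i j k l (wAt e B x μ ν k) (wAt e B x μ ν l) a b := by
  rw [mPair, bacc_eq_sum, bacc_eq_sum, lcurl_eq_sum, quadB_eq_sum]
  rw [bw_right, bw_right, bw_brL_mul, bw_br_mul, bw_br_mul, bw_brL_mul]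
  simp only [pPair, mul_add, mul_sub, Finset.mul_sum, ← Finset.sum_add_distrib, ← Finset.sum_sub_distrib]
  refine Finset.sum_congr rfl fun k _ => Finset.sum_congr rfl fun l _ => ?_
  ring

/-- **THE `(2,2)` COLOUR KERNEL POLARISED IN THE BACKGROUND**: `M22 τ t e B x μ ν i j a b = Σ_k Σ_l m22 τ t i j k l b_k b_l a b` with
`b_k = wAt e B x μ ν k` — fluctuation position pair `(i, j)` × background position pair `(k, l)` of one plaquette (distinct-bond cells `k ≠ l`,
contact cells `k = l`). [folklore] -/
theorem M22_polar (τ : 𝔸 →ₗ[ℝ] ℝ) (t : C → 𝔸) (e : D → Λ) (B : Λ → D → 𝔸) (x : Λ) (μ ν : D) (i j : Fin 4) (a b : C) :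
    M22 τ t e B x μ ν i j a b = ∑ k, ∑ l, m22 τ t i j k l (wAt e B x μ ν k) (wAt e B x μ ν l) a b := by
  by_cases h : i < j
  · simp only [M22, m22, if_pos h, mSym_polar, mPair_polar, ← Finset.sum_add_distrib, Finset.mul_sum]
  · simp only [M22, m22, if_neg h, add_zero, mSym_polar, Finset.mul_sum]

/-- THE CONTACT / DISTINCT-BOND SPLIT of the polarised kernel: `Σ_k m22(k,k) + Σ_k Σ_{l ≠ k} m22(k,l)`. [folklore] -/
theorem M22_polar_split (τ : 𝔸 →ₗ[ℝ] ℝ) (t : C → 𝔸) (e : D → Λ) (B : Λ → D → 𝔸) (x : Λ) (μ ν : D) (i j : Fin 4) (a b : C) :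
    M22 τ t e B x μ ν i j a b
      = (∑ k, m22 τ t i j k k (wAt e B x μ ν k) (wAt e B x μ ν k) a b)
        + ∑ k, ∑ l ∈ univ.erase k, m22 τ t i j k l (wAt e B x μ ν k) (wAt e B x μ ν l) a b := by
  rw [M22_polar, ← Finset.sum_add_distrib]
  refine Finset.sum_congr rfl fun k _ => ?_
  rw [← Finset.add_sum_erase _ _ (mem_univ k)]

variable {K : Type*} [Fintype K]

/-- `pSym` IS BILINEAR IN THE TWO BACKGROUND LETTERS: expansion along any finite family. [folklore] -/
theorem pSym_sum_sum (τ : 𝔸 →ₗ[ℝ] ℝ) (t : C → 𝔸) (i j k l : Fin 4) (Y : K → 𝔸) (γ δ : K → ℝ) (a b : C) :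
    pSym τ t i j k l (∑ m, γ m • Y m) (∑ n, δ n • Y n) a b = ∑ m, ∑ n, γ m * δ n * pSym τ t i j k l (Y m) (Y n) a b := by
  rw [pSym, sum_smul_mul_sum_smul, bw_brbr, bw_mul_br, bw_br_mul, bw_sandwich, bw_right, bw_brL_mul]
  simp only [pSym, mul_add, mul_sub, Finset.mul_sum, ← Finset.sum_add_distrib, ← Finset.sum_sub_distrib]
  refine Finset.sum_congr rfl fun m _ => Finset.sum_congr rfl fun n _ => ?_
  ring

/-- `pPair` IS BILINEAR IN THE TWO BACKGROUND LETTERS. [folklore] -/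
theorem pPair_sum_sum (τ : 𝔸 →ₗ[ℝ] ℝ) (t : C → 𝔸) (i j k l : Fin 4) (Y : K → 𝔸) (γ δ : K → ℝ) (a b : C) :
    pPair τ t i j k l (∑ m, γ m • Y m) (∑ n, δ n • Y n) a b = ∑ m, ∑ n, γ m * δ n * pPair τ t i j k l (Y m) (Y n) a b := by
  rw [pPair, sum_smul_mul_sum_smul, bw_right, bw_right, bw_brL_mul, bw_br_mul, bw_br_mul, bw_brL_mul]
  simp only [pPair, mul_add, mul_sub, Finset.mul_sum, ← Finset.sum_add_distrib, ← Finset.sum_sub_distrib]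
  refine Finset.sum_congr rfl fun m _ => Finset.sum_congr rfl fun n _ => ?_
  ring

/-- **`m22` IS BILINEAR IN THE TWO BACKGROUND LETTERS.** [folklore] -/
theorem m22_sum_sum (τ : 𝔸 →ₗ[ℝ] ℝ) (t : C → 𝔸) (i j k l : Fin 4) (Y : K → 𝔸) (γ δ : K → ℝ) (a b : C) :
    m22 τ t i j k l (∑ m, γ m • Y m) (∑ n, δ n • Y n) a b = ∑ m, ∑ n, γ m * δ n * m22 τ t i j k l (Y m) (Y n) a b := by
  by_cases h : i < j
  · simp only [m22, if_pos h, pSym_sum_sum, pPair_sum_sum, ← Finset.sum_add_distrib, Finset.mul_sum, mul_add]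
    refine Finset.sum_congr rfl fun m _ => Finset.sum_congr rfl fun n _ => ?_
    ring
  · simp only [m22, if_neg h, add_zero, pSym_sum_sum, Finset.mul_sum]
    refine Finset.sum_congr rfl fun m _ => Finset.sum_congr rfl fun n _ => ?_
    ring

end Polar

/-! ## §3 Full coordinates: the eight-index table -/

section Coordinates

variable {𝔸 : Type*} [NormedRing 𝔸] [NormedAlgebra ℝ 𝔸]
variable {Λ : Type*} [AddCommGroup Λ] {C : Type*} [Fintype C] {D : Type*}

/-- **THE EIGHT-INDEX TABLE** `K22 i j k l a b c d := m22 i j k l (t_c) (t_d) a b`: fluctuation (position, colour) pairs `(i,a), (j,b)`,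
background (position, colour) pairs `(k,c), (l,d)`; each entry a signed half-integer combination of values of `τ` at four-fold products of
the generators `t_a, t_b, t_c, t_d`. [folklore] -/
def K22 (τ : 𝔸 →ₗ[ℝ] ℝ) (t : C → 𝔸) (i j k l : Fin 4) (a b c d : C) : ℝ := m22 τ t i j k l (t c) (t d) a b

omit [Fintype C] in
/-- `K22` unfolded. [folklore] -/
theorem K22_eq (τ : 𝔸 →ₗ[ℝ] ℝ) (t : C → 𝔸) (i j k l : Fin 4) (a b c d : C) :
    K22 τ t i j k l a b c d = sgn i * sgn j * (pSym τ t i j k l (t c) (t d) a b + if i < j then pPair τ t i j k l (t c) (t d) a b else 0) :=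
  rfl

/-- the polarised kernel at a background in colour coordinates: `M22` at `B = field t u` through `K22`. [folklore] -/
theorem M22_field (τ : 𝔸 →ₗ[ℝ] ℝ) (t : C → 𝔸) (e : D → Λ) (u : Λ × (C × D) → ℝ) (x : Λ) (μ ν : D) (i j : Fin 4) (a b : C) :
    M22 τ t e (field t u) x μ ν i j a b
      = ∑ k, ∑ l, ∑ c, ∑ d, cv e u x μ ν k c * cv e u x μ ν l d * K22 τ t i j k l a b c d := by
  rw [M22_polar]
  refine Finset.sum_congr rfl fun k _ => Finset.sum_congr rfl fun l _ => ?_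
  rw [wAt_field, wAt_field, m22_sum_sum]
  rfl

/-- **THE `(2,2)` PLAQUETTE KERNEL IN FULL COORDINATES.**  For a tracial real-linear `τ`, a letter family `t : C → 𝔸` and real vectors
`v` (fluctuation) and `u` (background), at `W = field t v`, `B = field t u`:
`τ(P22(p_{μν}(x))) = Σ_{i,j} Σ_{a,b} v_i(a) v_j(b) · Σ_{k,l} Σ_{c,d} u_k(c) u_l(d) · K22 i j k l a b c d`. [folklore] -/
theorem trace_P22_plaqWord_field_field (τ : 𝔸 →ₗ[ℝ] ℝ) (hτ : ∀ a b : 𝔸, τ (a * b) = τ (b * a)) (t : C → 𝔸) (e : D → Λ)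
    (v u : Λ × (C × D) → ℝ) (x : Λ) (μ ν : D) :
    τ (P22 ℝ (plaqWord e (field t v) (field t u) x μ ν)) =
      ∑ i, ∑ j, ∑ a, ∑ b, cv e v x μ ν i a * cv e v x μ ν j b *
        ∑ k, ∑ l, ∑ c, ∑ d, cv e u x μ ν k c * cv e u x μ ν l d * K22 τ t i j k l a b c d := by
  simp only [trace_P22_plaqWord_field_kernel τ hτ, M22_field]

/-- the background-quadratic scaling in coordinates: `K22` is read at `s•u` with the factor `s²` carried by the two `u`-coordinates
(consistency with `PlaquetteVertex2Coords.M22_smul`). [folklore] -/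
theorem M22_field_smul (τ : 𝔸 →ₗ[ℝ] ℝ) (t : C → 𝔸) (e : D → Λ) (u : Λ × (C × D) → ℝ) (x : Λ) (μ ν : D) (s : ℝ) (i j : Fin 4)
    (a b : C) :
    M22 τ t e (field t (s • u)) x μ ν i j a b = s * s * M22 τ t e (field t u) x μ ν i j a b := by
  rw [M22_field, M22_field, Finset.mul_sum]
  refine Finset.sum_congr rfl fun k _ => ?_
  rw [Finset.mul_sum]
  refine Finset.sum_congr rfl fun l _ => ?_
  rw [Finset.mul_sum]
  refine Finset.sum_congr rfl fun c _ => ?_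
  rw [Finset.mul_sum]
  refine Finset.sum_congr rfl fun d _ => ?_
  simp only [cv, Pi.smul_apply, smul_eq_mul]
  ring

/-- THE SUMMED `(2,2)`-JET IN FULL COORDINATES. [folklore] -/
theorem jet22_field_field [Fintype Λ] [Fintype D] (τ : 𝔸 →ₗ[ℝ] ℝ) (hτ : ∀ a b : 𝔸, τ (a * b) = τ (b * a)) (t : C → 𝔸)
    (e : D → Λ) (v u : Λ × (C × D) → ℝ) :
    jet22 ℝ τ e (field t v) (field t u) =
      ∑ x, ∑ μ, ∑ ν, ∑ i, ∑ j, ∑ a, ∑ b, cv e v x μ ν i a * cv e v x μ ν j b *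
        ∑ k, ∑ l, ∑ c, ∑ d, cv e u x μ ν k c * cv e u x μ ν l d * K22 τ t i j k l a b c d := by
  simp only [jet22, trace_P22_plaqWord_field_field τ hτ]

end Coordinates

/-! ## §4 Examples -/

section Examples

/-- in a COMMUTATIVE algebra the polarised pair words vanish identically. [folklore] -/
example (τ : ℝ →ₗ[ℝ] ℝ) (t : Unit → ℝ) (i j k l : Fin 4) (Y Y' : ℝ) (a b : Unit) : pPair τ t i j k l Y Y' a b = 0 := by
  simp [pPair, br, mul_comm, mul_left_comm]

/-- in a COMMUTATIVE algebra only the scalar-slot word survives in `pSym`: `qq k l · ½τ(t_a t_b Y Y′)`. [folklore] -/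
example (τ : ℝ →ₗ[ℝ] ℝ) (t : Unit → ℝ) (i j k l : Fin 4) (Y Y' : ℝ) (a b : Unit) :
    pSym τ t i j k l Y Y' a b = qq k l * (2⁻¹ * τ (t a * t b * (Y * Y'))) := by
  simp [pSym, br, mul_comm, mul_left_comm]

/-- the incidence rows sum to `0, 1, 1, 0` (number of background letters seen, with orientation). [folklore] -/
example : (∑ k, inc 0 k, ∑ k, inc 1 k, ∑ k, inc 2 k, ∑ k, inc 3 k) = ((0 : ℝ), (1 : ℝ), (1 : ℝ), (0 : ℝ)) := by
  simp [inc, Fin.sum_univ_four]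

/-- the quadratic table sums to zero: `Σ_{k,l} qq k l = (1−1−1−1−1+1) + 4·½ = 0` (consistent with `quadB = 0` at a constant
abelian background, where `F = 0`). [folklore] -/
example : ∑ k, ∑ l, qq k l = 0 := by
  simp [qq, Fin.sum_univ_four]; norm_num

end Examples

end Literature.MathematicalPhysics.QuantumFieldTheory.Balaban1983to89.Beta.PlaquetteVertex2Polar
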